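import Summits.NavierStokesRegularity.NavierStokesRegularity.Theorems.HeredityAtOne.Negative.CappedStageAtBound
import Summits.NavierStokesRegularity.FluidComputer.ClayBlowupRows

/-!
# KJ-15 — `CappedStageAt k → SubfloorStageAt k` (`k ≥ 1`): the CAPPED trigger is a special case of the
SUB-FLOOR trigger

Refuter hygiene for the two negative lemmas of `HeredityAtOneFalseOfCappedStageAtOne` (item 19249, plain
Negative lane): its §1 template `SubfloorStageAt k → ¬ HeredityAt k` and its §2 lever
`CappedStageAt k → ¬ HeredityAt k` are not two triggers but one — for `k ≥ 1` (the quiet era)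

* `exists_global_solution_of_speed_bound` / `exists_classical_continuation_of_speed_bound` — if the
  `τ_k`-state of a registered level-`k` stage of a quiet design has every unforced finite-energy classical
  slab-continuation speed-bounded by `B` (the cap-free content of `CappedStageAt k`,
  `cappedStageAt_iff_exists_speed_bound`), then the design's Clay data launch a GLOBAL classical solution with
  bounded energy, equal to the stage on `[0, τ_k]` and with speed `≤ B` for all `t ≥ τ_k` — in particular a
  finite-energy classical solution on `[0, τ_{k+1}]` from the Clay datum with speed `≤ B` on the window. Mechanism: the Leray–Clay dichotomy for the design's Clay data
  (`ClayEvolution.exists_claySolution_or_clayBlowup`) — a Clay blow-up from the design's data is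
  impossible (at ANY lifespan), because before `τ_k` its flow IS the stage (forced Serrin–Masuda uniqueness,
  `velocity_eq_of_bounded_classical`, bounded by the register ceiling `c₂ Y_k`) and after `τ_k` it is
  bounded by `B` (the cap binds every slab `[τ_k, T']`, the force being silent from `τ_1` on), contradicting
  `ClayBlowup.velocity_unbounded`; so the design's evolution is a GLOBAL Clay solution, restricted here to `[0, τ_{k+1}]`;
* `subfloorStageAt_of_cappedStageAt` — `CappedStageAt k → SubfloorStageAt k` (`B < c₁ Y_{k+1}` is the
  sub-floor readout everywhere, a fortiori on the readout ball);
* `subfloorStageAtOne_of_cappedStageAtOne`, and `heredityAtOne_false_of_cappedStageAtOne'` — the landed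
  `HeredityAtOne_false_of_CappedStageAtOne` re-obtained THROUGH the sub-floor template.

Consequence for the trigger census (planner (t2′a)/(t2′b)): (t2′b) ⊆ (t2′a). The converse fails as a matter of
typing (a sub-floor readout at `τ_{k+1}` on the ball says nothing about all times / all places / all
continuations), so `SubfloorStageAt k` remains the sharper hypothesis. Theorems only.
WHAT THIS IS NOT: not a statement about Navier–Stokes dynamics beyond the tree's discharged Clay dichotomy and
weak–strong uniqueness; no stage, design or bound `B` is constructed.
-/

namespace Summit.NavierStokesRegularity.HeredityAtOneSpeedCap

open Set MeasureTheory
open scoped ENNReal ContDiff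
open Literature.Analysis.FluidPDE
open Summit.NavierStokesRegularity.FluidComputer
open Summit.NavierStokesRegularity.FluidComputer.PalasekTowerClayBridge
open Summit.NavierStokesRegularity.NavierStokesRegularity

/-- **A speed-bounded unforced future makes the design GLOBALLY regular** (`k ≥ 1`, quiet design). If every
unforced finite-energy classical slab-solution starting from the `τ_k`-state of a registered level-`k` stage
`s` has speed `≤ B`, then the design's Clay data `(S.u₀, S.f)` launch a GLOBAL classical solution with
bounded energy, equal to `s` on `[0, τ_k]` and with speed `≤ B` at all times `t ≥ τ_k`: in the Leray–Clay
dichotomy the blow-up alternative is void — before `τ_k` a blow-up's flow IS the stage (forced weak–strong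
uniqueness, bounded by the register ceiling `c₂ Y_k`), after `τ_k` the cap binds every slab, contradicting
`ClayBlowup.velocity_unbounded`. [cite: Leray1934, §32] [cite: Sohr2001, Ch. V Thm. 1.5.1] -/
theorem exists_global_solution_of_speed_bound {k : ℕ} (hk : 1 ≤ k)
    {S : Schedule TowerRates.wide}
    (s : Stage 1 TowerRates.wide S (Margins.routeG TowerRates.wide) k) (hQ : S.Quiet) {B : ℝ}
    (hbd : ∀ ⦃a b : ℝ⦄, a < b →
      ∀ (f u : ℝ → EuclideanSpace ℝ (Fin 3) → EuclideanSpace ℝ (Fin 3))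
        (p : ℝ → EuclideanSpace ℝ (Fin 3) → ℝ),
        IsClassicalNSSolutionOn (Icc a b) 1 f u p → (∀ t ∈ Icc a b, f t = 0) →
        (∃ C : ℝ≥0∞, C < ⊤ ∧ ∀ t ∈ Icc a b, ∫⁻ x, ‖u t x‖ₑ ^ 2 ≤ C) →
        u a = s.u (S.τ k) → ∀ t ∈ Icc a b, ∀ x, ‖u t x‖ ≤ B) :
    ∃ (U : ℝ → EuclideanSpace ℝ (Fin 3) → EuclideanSpace ℝ (Fin 3))
      (P : ℝ → EuclideanSpace ℝ (Fin 3) → ℝ),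
      IsClassicalNSSolutionOn (Ici 0) 1 S.f U P ∧ U 0 = S.u₀ ∧ HasBoundedEnergy U ∧
      (∀ t ∈ Icc 0 (S.τ k), U t = s.u t) ∧ ∀ t, S.τ k ≤ t → ∀ x, ‖U t x‖ ≤ B := by
  have hτk : 0 < S.τ k := S.τ_pos k
  -- the quiet era: the force vanishes from `τ_k` on (`τ_1 ≤ τ_k`)
  have hf0 : ∀ t, S.τ k ≤ t → S.f t = 0 := fun t ht => hQ t ((S.τ_mono hk).trans ht)
  -- the design's datum is Clay data (smooth and divergence free, read off the stage; decay by design)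
  have hu₀C : ContDiff ℝ ∞ S.u₀ := by
    have h := s.classical.contDiff_velocity (t := 0) ⟨le_rfl, hτk.le⟩
    rwa [s.initial] at h
  have hdiv : NSWave0.IsDivFree S.u₀ := by
    have h := s.classical.divFree 0 ⟨le_rfl, hτk.le⟩
    rwa [s.initial] at h
  -- KEY: a finite-energy classical solution of the design's system on `[0, T']`, `T' > τ_k`, from the datum
  -- IS the stage before `τ_k` and obeys the bound `B` on `[τ_k, T']`
  have key : ∀ {T' : ℝ}, S.τ k < T' →
      ∀ {v : ℝ → EuclideanSpace ℝ (Fin 3) → EuclideanSpace ℝ (Fin 3)}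
        {q : ℝ → EuclideanSpace ℝ (Fin 3) → ℝ},
        IsClassicalNSSolutionOn (Icc 0 T') 1 S.f v q → v 0 = S.u₀ →
        (∃ C : ℝ≥0∞, C < ⊤ ∧ ∀ t ∈ Icc 0 T', ∫⁻ x, ‖v t x‖ₑ ^ 2 ≤ C) →
        (∀ t ∈ Icc 0 (S.τ k), v t = s.u t) ∧ ∀ t ∈ Icc (S.τ k) T', ∀ x, ‖v t x‖ ≤ B := by
    intro T' hT' v q hv hv0 hEv
    have hagree : ∀ t ∈ Icc 0 (S.τ k), v t = s.u t :=
      s.velocity_eq_of_classical one_pos hT'.le hv hv0 hEv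
    refine ⟨hagree, hbd hT' S.f v q (hv.mono (Icc_subset_Icc hτk.le le_rfl) (uniqueDiffOn_Icc hT'))
      (fun t ht => hf0 t ht.1) ?_ (hagree _ ⟨hτk.le, le_rfl⟩)⟩
    obtain ⟨C, hC, hCE⟩ := hEv
    exact ⟨C, hC, fun t ht => hCE t ⟨hτk.le.trans ht.1, ht.2⟩⟩
  rcases ClayEvolution.exists_claySolution_or_clayBlowup one_pos hu₀C hdiv S.datum_decay
      S.force_smooth S.force_decay with ⟨U, P, hUs, hPs, hns, hE⟩ | ⟨X, hX0, hXf⟩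
  · -- a global Clay solution: the KEY applies on every slab `[0, t + 1]`, `t ≥ τ_k`
    obtain ⟨hcl, hU0⟩ := isNavierStokesSolution_and_smooth_iff.1 ⟨hns, hUs, hPs⟩
    have hslab : ∀ {T' : ℝ}, 0 < T' →
        IsClassicalNSSolutionOn (Icc 0 T') 1 S.f U P ∧
          ∃ C : ℝ≥0∞, C < ⊤ ∧ ∀ t ∈ Icc 0 T', ∫⁻ x, ‖U t x‖ₑ ^ 2 ≤ C := by
      intro T' hT'
      obtain ⟨C, hC, hCE⟩ := hE
      exact ⟨hcl.mono Icc_subset_Ici_self (uniqueDiffOn_Icc hT'), C, hC, fun t ht => hCE t ht.1⟩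
    refine ⟨U, P, hcl, hU0, hE, ?_, fun t ht x => ?_⟩
    · obtain ⟨hc, hEc⟩ := hslab (hτk.trans (lt_add_one (S.τ k)))
      exact (key (lt_add_one (S.τ k)) hc hU0 hEc).1
    · obtain ⟨hc, hEc⟩ := hslab (hτk.trans_le (ht.trans (lt_add_one t).le))
      exact (key (ht.trans_lt (lt_add_one t)) hc hU0 hEc).2 t ⟨ht, (lt_add_one t).le⟩ x
  · -- a Clay blow-up `X` from the design's data is IMPOSSIBLE: before `τ_k` its flow IS the stage
    -- (short-slab uniqueness, bounded by the register ceiling), after `τ_k` it is bounded by `B`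
    exfalso
    refine X.velocity_unbounded one_pos ⟨max (S.c₂ * TowerRates.wide.Y k) B, fun t ht x => ?_⟩
    -- a closed sub-slab `[0, T']` of the blow-up containing `t`
    have h1 : t < (t + X.T) / 2 := by linarith [ht.2]
    have h2 : (t + X.T) / 2 < X.T := by linarith [ht.2]
    have h0 : 0 < (t + X.T) / 2 := by linarith [ht.1, ht.2]
    have hXc : IsClassicalNSSolutionOn (Icc 0 ((t + X.T) / 2)) 1 S.f X.u X.p := by
      rw [← hXf]
      exact X.classical_Icc h0 h2
    have hXE := X.energy _ h2
    by_cases htk : t ≤ S.τ k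
    · have hm0 : 0 < min ((t + X.T) / 2) (S.τ k) := lt_min h0 hτk
      have hsc : IsClassicalNSSolutionOn (Icc 0 (min ((t + X.T) / 2) (S.τ k))) 1 S.f s.u s.p :=
        s.classical.mono (Icc_subset_Icc le_rfl (min_le_right _ _)) (uniqueDiffOn_Icc hm0)
      have hsE : ∃ C : ℝ≥0∞, C < ⊤ ∧
          ∀ t' ∈ Icc 0 (min ((t + X.T) / 2) (S.τ k)), ∫⁻ x, ‖s.u t' x‖ₑ ^ 2 ≤ C := by
        obtain ⟨C, hC, hCE⟩ := s.energy
        exact ⟨C, hC, fun t' ht' => hCE t' ⟨ht'.1, ht'.2.trans (min_le_right _ _)⟩⟩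
      have hXc' : IsClassicalNSSolutionOn (Icc 0 (min ((t + X.T) / 2) (S.τ k))) 1 S.f X.u X.p :=
        hXc.mono (Icc_subset_Icc le_rfl (min_le_left _ _)) (uniqueDiffOn_Icc hm0)
      have hXE' : ∃ C : ℝ≥0∞, C < ⊤ ∧
          ∀ t' ∈ Icc 0 (min ((t + X.T) / 2) (S.τ k)), ∫⁻ x, ‖X.u t' x‖ₑ ^ 2 ≤ C := by
        obtain ⟨C, hC, hCE⟩ := hXE
        exact ⟨C, hC, fun t' ht' => hCE t' ⟨ht'.1, ht'.2.trans (min_le_left _ _)⟩⟩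
      have heq : X.u t = s.u t :=
        velocity_eq_of_bounded_classical one_pos hm0 S.force_smooth S.force_decay hsc hsE
          (fun t' ht' x => s.ceiling k le_rfl t' ⟨ht'.1, ht'.2.trans (min_le_right _ _)⟩ x)
          hXc' hXE' (hX0.trans s.initial.symm) t ⟨ht.1, le_min h1.le htk⟩
      rw [heq]
      exact (s.ceiling k le_rfl t ⟨ht.1, htk⟩ x).trans (le_max_left _ _)
    · push Not at htk
      exact ((key (htk.trans h1) hXc hX0 hXE).2 t ⟨htk.le, h1.le⟩ x).trans (le_max_right _ _)

/-- **… in particular the design's flow continues classically through `τ_{k+1}`** with finite energy,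
equal to `s` on `[0, τ_k]`, and with speed `≤ B` on the window `[τ_k, τ_{k+1}]`.
[cite: Leray1934, §32] [cite: Sohr2001, Ch. V Thm. 1.5.1] -/
theorem exists_classical_continuation_of_speed_bound {k : ℕ} (hk : 1 ≤ k)
    {S : Schedule TowerRates.wide}
    (s : Stage 1 TowerRates.wide S (Margins.routeG TowerRates.wide) k) (hQ : S.Quiet) {B : ℝ}
    (hbd : ∀ ⦃a b : ℝ⦄, a < b →
      ∀ (f u : ℝ → EuclideanSpace ℝ (Fin 3) → EuclideanSpace ℝ (Fin 3))
        (p : ℝ → EuclideanSpace ℝ (Fin 3) → ℝ),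
        IsClassicalNSSolutionOn (Icc a b) 1 f u p → (∀ t ∈ Icc a b, f t = 0) →
        (∃ C : ℝ≥0∞, C < ⊤ ∧ ∀ t ∈ Icc a b, ∫⁻ x, ‖u t x‖ₑ ^ 2 ≤ C) →
        u a = s.u (S.τ k) → ∀ t ∈ Icc a b, ∀ x, ‖u t x‖ ≤ B) :
    ∃ (u : ℝ → EuclideanSpace ℝ (Fin 3) → EuclideanSpace ℝ (Fin 3))
      (p : ℝ → EuclideanSpace ℝ (Fin 3) → ℝ),
      IsClassicalNSSolutionOn (Icc 0 (S.τ (k + 1))) 1 S.f u p ∧ u 0 = S.u₀ ∧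
      (∃ C : ℝ≥0∞, C < ⊤ ∧ ∀ t ∈ Icc 0 (S.τ (k + 1)), ∫⁻ x, ‖u t x‖ₑ ^ 2 ≤ C) ∧
      (∀ t ∈ Icc 0 (S.τ k), u t = s.u t) ∧ ∀ t ∈ Icc (S.τ k) (S.τ (k + 1)), ∀ x, ‖u t x‖ ≤ B := by
  obtain ⟨U, P, hcl, hU0, ⟨C, hC, hCE⟩, hagree, hB⟩ :=
    exists_global_solution_of_speed_bound hk s hQ hbd
  exact ⟨U, P, hcl.mono Icc_subset_Ici_self (uniqueDiffOn_Icc (S.τ_pos (k + 1))), hU0,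
    ⟨C, hC, fun t ht => hCE t ht.1⟩, hagree, fun t ht x => hB t ht.1 x⟩

/-- **KJ-15: `CappedStageAt k → SubfloorStageAt k`** (`k ≥ 1`) — the capped trigger (t2′b) is a special case
of the sub-floor trigger (t2′a): the speed bound `B < c₁ Y_{k+1}` of the `τ_k`-state's unforced future is
realised by the design's own flow, which is a finite-energy classical competitor on `[0, τ_{k+1}]` with
sub-floor speed at `τ_{k+1}` everywhere. [cite: Palasek2026ElementaryModel, §4] [cite: Leray1934, §32] -/
theorem subfloorStageAt_of_cappedStageAt {k : ℕ} (hk : 1 ≤ k) (h : CappedStageAt k) :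
    SubfloorStageAt k := by
  obtain ⟨S, s, B, hP, hR, hQ, hBlt, hcap⟩ := (cappedStageAt_iff_exists_speed_bound k).1 h
  obtain ⟨u, p, hcl, hu0, hE, -, hbd⟩ := exists_classical_continuation_of_speed_bound hk s hQ hcap
  exact ⟨S, u, p, hP, hR, hQ, ⟨s⟩, hcl, hu0, hE,
    fun x _ => (hbd _ ⟨(S.τ_lt_succ k).le, le_rfl⟩ x).trans_lt hBlt⟩

/-- `CappedStageAtOne → SubfloorStageAt 1`. [cite: Palasek2026ElementaryModel, §4] -/
theorem subfloorStageAtOne_of_cappedStageAtOne (h : CappedStageAtOne) : SubfloorStageAt 1 :=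
  subfloorStageAt_of_cappedStageAt le_rfl h

/-- The landed lever `HeredityAtOne_false_of_CappedStageAtOne` FACTORS through the sub-floor template
`heredityAtOne_false_of_subfloorStageAtOne`. [cite: Palasek2026ElementaryModel, §4] -/
theorem heredityAtOne_false_of_cappedStageAtOne' (h : CappedStageAtOne) :
    ¬ Theses.PalasekTowerBreakdown.HeredityAtOne :=
  heredityAtOne_false_of_subfloorStageAtOne (subfloorStageAtOne_of_cappedStageAtOne h)

end Summit.NavierStokesRegularity.HeredityAtOneSpeedCap
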